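import Summits.SmoothPoincare4.SmoothPoincare4.Theses.SymplecticOrigami

/-!
# Constant forms on open subsets of `ℝⁿ` are smooth and closed (support for crux stmt-SmoothPoincare4-7842)

Generic plumbing for the negative lemma `Negative.NoncompactDoor` of the crux
`SymplecticOrigami.NoGenusTwoDoor`: on an open subset `V ⊆ ℝⁿ` with Mathlib's
`TopologicalSpace.Opens` charted-space structure (one chart: the inclusion), the tangent
identification along the inverse chart is the identity on the chart target
(`mfderivWithin_extChartAt_symm_eq_id`), so the chart representative of a CONSTANT form
`x ↦ c` in the tree's `MForm` vocabulary is locally the constant `c` (`inChart_const_eventuallyEq`);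
hence constant forms are chartwise smooth (`isSmoothForm_const`) and closed (`isClosedForm_const`).
No definitions; everything is proved. Refuter support file (cdisprove seat), supports the crux item.
-/

noncomputable section

-- the prescribed namespace `Summit.<P>.<Sub>.…` duplicates `SmoothPoincare4` (P = Sub)
set_option linter.dupNamespace false

open scoped Manifold ContDiff Topology
open Set Filter Literature.Geometry.Kaehler

namespace Summit.SmoothPoincare4.SmoothPoincare4.Theorems.NoGenusTwoDoor.Negative

variable {n : ℕ} {V : TopologicalSpace.Opens (EuclideanSpace ℝ (Fin n))}

/-- On an open subset of the model space the derivative of the extended chart (the inclusion),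
read in charts, is the identity. [folklore] -/
theorem mfderiv_extChartAt_eq_id (x : V) {z : V} (hz : z ∈ (chartAt (EuclideanSpace ℝ (Fin n)) x).source) :
    mfderiv (𝓡 n) 𝓘(ℝ, EuclideanSpace ℝ (Fin n)) (extChartAt (𝓡 n) x) z =
      ContinuousLinearMap.id ℝ (EuclideanSpace ℝ (Fin n)) := by
  rw [(hasMFDerivAt_extChartAt hz).mfderiv, mfderiv_chartAt_eq_tangentCoordChange hz]
  have hz' : z ∈ (extChartAt (𝓡 n) x).source := by rwa [extChartAt_source]
  refine ContinuousLinearMap.ext fun v ↦ ?_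
  change tangentCoordChange (𝓡 n) x x z v = v
  exact tangentCoordChange_self hz'

/-- Hence the tangent identification along the inverse extended chart is the identity at every
point of the chart target. [folklore] -/
theorem mfderivWithin_extChartAt_symm_eq_id (x : V) {y : EuclideanSpace ℝ (Fin n)}
    (hy : y ∈ (extChartAt (𝓡 n) x).target) :
    mfderivWithin 𝓘(ℝ, EuclideanSpace ℝ (Fin n)) (𝓡 n) (extChartAt (𝓡 n) x).symm (range (𝓡 n)) y =
      ContinuousLinearMap.id ℝ (EuclideanSpace ℝ (Fin n)) := by
  have h := mfderiv_extChartAt_comp_mfderivWithin_extChartAt_symm (I := 𝓡 n) hy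
  have hz : (extChartAt (𝓡 n) x).symm y ∈ (chartAt (EuclideanSpace ℝ (Fin n)) x).source := by
    rw [← extChartAt_source (I := 𝓡 n)]
    exact (extChartAt (𝓡 n) x).map_target hy
  rw [mfderiv_extChartAt_eq_id x hz] at h
  exact ContinuousLinearMap.ext fun v ↦ DFunLike.congr_fun h v

variable {k : ℕ}

/-- The chart representative at `x` of the constant form `x ↦ c` on `V` agrees with the constant
`c` near the image of `x`. [folklore] -/
theorem inChart_const_eventuallyEq (c : (EuclideanSpace ℝ (Fin n)) [⋀^Fin k]→L[ℝ] ℝ) (x : V) :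
    MForm.inChart (I := 𝓡 n) (M := V) (F := ℝ) (k := k) (fun _ ↦ c) x =ᶠ[𝓝 (extChartAt (𝓡 n) x x)] fun _ ↦ c := by
  filter_upwards [extChartAt_target_mem_nhds (I := 𝓡 n) x] with y hy
  ext v
  rw [MForm.inChart_apply]
  change c _ = c v
  congr 1
  funext i
  exact DFunLike.congr_fun (mfderivWithin_extChartAt_symm_eq_id x hy) (v i)

/-- **Constant forms on open subsets of `ℝⁿ` are chartwise smooth.** [folklore] -/
theorem isSmoothForm_const (c : (EuclideanSpace ℝ (Fin n)) [⋀^Fin k]→L[ℝ] ℝ) :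
    IsSmoothForm (I := 𝓡 n) (M := V) (F := ℝ) (k := k) (fun _ ↦ c) := fun x ↦
  (contDiffWithinAt_const (c := c)).congr_of_eventuallyEq
    ((inChart_const_eventuallyEq c x).filter_mono nhdsWithin_le_nhds)
    (inChart_const_eventuallyEq c x).eq_of_nhds

/-- The exterior derivative (within any set) of a constant form on a normed space vanishes. [folklore] -/
theorem extDerivWithin_const_eq_zero {E : Type*} [NormedAddCommGroup E] [NormedSpace ℝ E]
    (c : E [⋀^Fin k]→L[ℝ] ℝ) (s : Set E) (y : E) : extDerivWithin (fun _ : E ↦ c) s y = 0 := by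
  rw [extDerivWithin, fderivWithin_const_apply,
    ← ContinuousAlternatingMap.alternatizeUncurryFinCLM_apply, map_zero]

/-- **Constant forms on open subsets of `ℝⁿ` are closed.** [folklore] -/
theorem isClosedForm_const (c : (EuclideanSpace ℝ (Fin n)) [⋀^Fin k]→L[ℝ] ℝ) :
    IsClosedForm (I := 𝓡 n) (M := V) (F := ℝ) (k := k) (fun _ ↦ c) := by
  funext x
  have h1 : extDerivWithin (MForm.inChart (I := 𝓡 n) (M := V) (F := ℝ) (k := k) (fun _ ↦ c) x) (range (𝓡 n))
      (extChartAt (𝓡 n) x x) = 0 := by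
    rw [((inChart_const_eventuallyEq c x).filter_mono nhdsWithin_le_nhds).extDerivWithin_eq
      (inChart_const_eventuallyEq c x).eq_of_nhds]
    exact extDerivWithin_const_eq_zero _ _ _
  show (extDerivWithin (MForm.inChart (I := 𝓡 n) (M := V) (F := ℝ) (k := k) (fun _ ↦ c) x) (range (𝓡 n))
    (extChartAt (𝓡 n) x x)).compContinuousLinearMap _ = 0
  rw [h1]
  ext v
  simp

end Summit.SmoothPoincare4.SmoothPoincare4.Theorems.NoGenusTwoDoor.Negative

end
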